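import Literature.IUT.HodgeTheaters.Conventions
import Literature.IUT.HodgeTheaters.ConventionsNumbers
import Literature.AnabelianGeometry.AbsoluteAnabelian.FundamentalExtension
import Literature.AnabelianGeometry.SemiGraphs.NotationsConventions
import HarnessLib

/-!
# [IUTchI] §0 "Numbers" / "Monoids and Categories": NF / MLF / CAF and "abstractly equivalent" agree with the prerequisite papers' typing — the bridge, PROOFS

Mochizuki, *Inter-universal Teichmüller theory I*, kurims manuscript (May 2020), §0 "Numbers", p. 35
[cite: Mochizuki2012, §0 p.35]: "NF", "MLF", "CAF" are recalled there from "[AbsTopI], §0;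
[AbsTopIII], §0" (D-0012 claim key; nothing on this page is contested).  The cell abc-iut holds TWO
transcriptions: `Literature.IUT.HodgeTheaters.IsNF/IsMLF/IsCAF` (`ConventionsNumbers.lean`, seat
abc-iut-L5-t1) and `Literature.AnabelianGeometry.AbsoluteAnabelian.IsNF/IsMLF/IsCAF`
(`FundamentalExtension.lean`, seat abc-iut-L4-t1, [AbsTopI] §0 p. 7 / [AbsTopIII] §0 p. 25).
PROOF-ONLY bridge (abc-iut-L5-t11; the DEDUP debt recorded by the L5-lead 2026-08-25T18:23:15Z,
settled without touching either frozen file): the three pairs of predicates are EQUIVALENT — indeed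
literally the same conditions (Mathlib `NumberField`; a ring homomorphism `ℚ_p → K` of finite degree;
a bicontinuous field isomorphism with `ℂ`).  Likewise §0 "Monoids and Categories", p. 35
"abstractly equivalent" functors: `Literature.IUT.HodgeTheaters.AbstractlyEquivalent`
(`Conventions.lean`, abc-iut-L5-t1) ↔ `Literature.AnabelianGeometry.SemiGraphs.AreAbstractlyEquivalent`
(`NotationsConventions.lean`, abc-iut-L3, [SemiAnbd] §0 p. 7) — the same 1-commutative square of
equivalences.  No statement is strengthened; nothing is asserted.
-/

namespace Literature.IUT.HodgeTheaters

universe v₁ v₂ v₃ v₄ u u₁ u₂ u₃ u₄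

/-! ### "Monoids and Categories": abstractly equivalent functors (p. 35 ↔ [SemiAnbd] §0 p. 7) -/

section AbstractlyEquivalent

open CategoryTheory

variable {C₁ : Type u₁} [Category.{v₁} C₁] {C₂ : Type u₂} [Category.{v₂} C₂]
  {C₁' : Type u₃} [Category.{v₃} C₁'] {C₂' : Type u₄} [Category.{v₄} C₂']

/-- **Abstractly equivalent functors**: the [IUTchI] §0 predicate `AbstractlyEquivalent φ φ'` ("there
exist isomorphisms `α_i : C_i ⥲ C_i'` such that `φ' ∘ α₁ = α₂ ∘ φ`", p. 35) ↔ the [SemiAnbd] §0 p. 7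
predicate `SemiGraphs.AreAbstractlyEquivalent φ φ'` (a nonempty type of such squares).
[cite: Mochizuki2012, §0 p.35] -/
theorem abstractlyEquivalent_iff_semiGraphs (φ : C₁ ⥤ C₂) (φ' : C₁' ⥤ C₂') :
    AbstractlyEquivalent φ φ' ↔
      Literature.AnabelianGeometry.SemiGraphs.AreAbstractlyEquivalent φ φ' := by
  constructor
  · rintro ⟨α₁, α₂, ⟨i⟩⟩
    exact ⟨⟨α₁, α₂, i⟩⟩
  · rintro ⟨⟨α₁, α₂, i⟩⟩
    exact ⟨α₁, α₂, ⟨i⟩⟩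

end AbstractlyEquivalent

/-! ### "Numbers": NF, MLF, CAF (p. 35 ↔ [AbsTopI] §0 p. 7, [AbsTopIII] §0 p. 25) -/

/-- **NF**: the [IUTchI] §0 predicate `IsNF` (= Mathlib `NumberField`) ↔ the [AbsTopI] §0 predicate
`AbsoluteAnabelian.IsNF`. [cite: Mochizuki2012, §0 p.35] -/
theorem isNF_iff_absoluteAnabelian (F : Type u) [Field F] :
    IsNF F ↔ Literature.AnabelianGeometry.AbsoluteAnabelian.IsNF F :=
  (Literature.AnabelianGeometry.AbsoluteAnabelian.isNF_iff F).symm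

/-- **MLF**: the [IUTchI] §0 predicate `IsMLF` ("a finite extension of `ℚ_p` for some prime number
`p`") ↔ the [AbsTopI] §0 predicate `AbsoluteAnabelian.IsMLF` (the same existential over `p` and
`ℚ_p → K`). [cite: Mochizuki2012, §0 p.35] -/
theorem isMLF_iff_absoluteAnabelian (K : Type u) [Field K] :
    IsMLF K ↔ Literature.AnabelianGeometry.AbsoluteAnabelian.IsMLF K :=
  (Literature.AnabelianGeometry.AbsoluteAnabelian.isMLF_iff K).symm

/-- **CAF**: the [IUTchI] §0 predicate `IsCAF` ("a topological field isomorphic to the field of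
complex numbers") ↔ the [AbsTopIII] §0 predicate `AbsoluteAnabelian.IsCAF`.
[cite: Mochizuki2012, §0 p.35] -/
theorem isCAF_iff_absoluteAnabelian (K : Type u) [Field K] [TopologicalSpace K] :
    IsCAF K ↔ Literature.AnabelianGeometry.AbsoluteAnabelian.IsCAF K :=
  (Literature.AnabelianGeometry.AbsoluteAnabelian.isCAF_iff K).symm

end Literature.IUT.HodgeTheaters
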